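import Literature.MathematicalPhysics.QuantumLattice.HubbardWave0
import HarnessLib

/-!
# The Nagaoka–Tasaki theorem: saturated ferromagnetism of the `U = ∞` Hubbard model with one hole

Trunk T-QLATTICE (Literature/MathematicalPhysics/QuantumLattice); cite item `wi-03677` (route
HubbardSuperconductivity/NoGo, crux #3, lemma #5).

**Theorem** (Nagaoka 1966, §3; Tasaki 1989, Phys. Rev. B 40, 9192, Theorem; Tasaki 1998, §4).
Consider the `U = ∞` Hubbard model — hopping `-t Σ_{⟨x,y⟩,σ} c†_{xσ} c_{yσ}` with `t ≥ 0`
(in the convention `H = -t Σ …`; on bipartite lattices the sign is irrelevant) restricted to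
states with NO doubly occupied site — on a finite lattice `Λ` (graph `G`) with `N = |Λ| - 1`
electrons (exactly one hole). If `Λ` satisfies Tasaki's *connectivity condition* (every two
one-hole spin configurations with the same `S^z` are connected by successive hops of the hole
along edges of `G`), then every ground state has maximal total spin `S = N/2`
(`S² ψ = S(S+1) ψ`), and the ground state is unique apart from the `(2S+1)`-fold spin degeneracy.
Nothing is claimed at fixed hole DENSITY or finite `U` (there, only variational instability of the
saturated state for `δ ≳ 0.29` on the square lattice is known).

**Erratum (sign of `t`) and removal of the named fact.** Tasaki writes the hopping term WITHOUT
a minus sign, `H_hop = Σ_{x,y,σ} t_{xy} c†_{xσ} c_{yσ}`, and proves the theorem for `t_{xy} ≥ 0` —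
"opposite from the standard choice" (Tasaki 1998, footnotes to eq. (2.2) and to Theorem 6.3). In the
tree's convention `-t Σ c†c` this is `t ≤ 0`, not the `0 < t` assumed by the named fact originally
vendored in this file (cite item `wi-03677`), which is therefore FALSE on non-bipartite graphs (on
bipartite ones the two signs are gauge-equivalent). The companion file `NagaokaTasakiProofs.lean`
refutes that original statement (`not_nagaoka_tasaki`, the triangle; its type is the original
statement verbatim, negated) and states and PROVES the corrected version `nagaoka_tasaki_neg`
(`nagaoka_tasaki_neg_holds`). The mis-stated `def` itself has been REMOVED from this file
(2026-08-15, refactor item `wi-18006`): this is a VOCABULARY module imported by route files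
(`Theses/HyperoctahedralMott`, `Theses/ProjectedBCSGas` of `HubbardSuperconductivity`) for
`gutzwillerProj` / `IsGutzwiller` / `HasDoubleOccupancy`, and a vocabulary module must not carry a
named fact that can never be discharged. Nothing else changed; the theorem lives, correctly signed
and proved, in the companion file.

## How it is typed (tree vocabulary of `HubbardWave0.lean`)

Fock space `Fock (Orb Λ) = Finset (Orb Λ) → ℂ` (occupation-set basis), `numberOp`, `hamiltonian G t U`,
`IsNParticle`, `expect`, `spinSq`. New here: the Gutzwiller (no-double-occupancy) constraint as a
predicate on basis sets / vectors and as the diagonal projector `gutzwillerProj`, the `U = ∞`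
Hamiltonian `hubbardInfty G t = P (hamiltonian G t 0) P`, projected-sector ground energies/states,
one-hole configurations and Tasaki's connectivity condition as connectedness of the hole-hopping
graph on them (Mathlib `SimpleGraph.Connected`). (The theorem itself — statement and proof — is in
`NagaokaTasakiProofs.lean`: `nagaoka_tasaki_neg`, `nagaoka_tasaki_neg_holds`.)

## Sources

* Y. Nagaoka, *Ferromagnetism in a narrow, almost half-filled s band*, Phys. Rev. 147 (1966), §3.
* H. Tasaki, *Extension of Nagaoka's theorem on the large-U Hubbard model*, Phys. Rev. B 40 (1989)
  9192–9193, Theorem and the connectivity condition.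
* H. Tasaki, *The Hubbard model — an introduction and selected rigorous results*, J. Phys. Cond.
  Mat. 10 (1998) 4353, §4.
-/

noncomputable section

open Matrix Finset

namespace Literature.MathematicalPhysics.QuantumLattice

variable {Λ : Type*} [LinearOrder Λ] [Fintype Λ]

/-! ### No double occupancy (`U = ∞` constraint) -/

/-- An occupation set `s ⊆ Orb Λ` has a doubly occupied site. [Tasaki 1989 (the `U = ∞`
constraint)] [folklore] -/
def HasDoubleOccupancy (s : Finset (Orb Λ)) : Prop :=
  ∃ x : Λ, orb x 0 ∈ s ∧ orb x 1 ∈ s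

/-- Double occupancy of a finite occupation set is decidable (finite `∃`). [folklore] -/
instance (s : Finset (Orb Λ)) : Decidable (HasDoubleOccupancy s) := by
  unfold HasDoubleOccupancy; infer_instance

/-- A Fock vector obeys the Gutzwiller constraint: no amplitude on doubly occupied configurations.
[Tasaki 1989; Tasaki 1998, §4 (restricted Hilbert space of the `U = ∞` model)] [cite: Tasaki1989, Theorem] -/
def IsGutzwiller (ψ : Fock (Orb Λ)) : Prop :=
  ∀ s, HasDoubleOccupancy s → ψ s = 0

/-- The Gutzwiller projector `P = Π_x (1 - n_{x↑} n_{x↓})`, written directly as the diagonal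
projector onto configurations without double occupancy. [Tasaki 1998, §4] [cite: Tasaki1989, Theorem] -/
def gutzwillerProj : Matrix (Finset (Orb Λ)) (Finset (Orb Λ)) ℂ :=
  Matrix.diagonal fun s => if HasDoubleOccupancy s then 0 else 1

variable (G : SimpleGraph Λ) [DecidableRel G.Adj]

/-- The `U = ∞` Hubbard Hamiltonian `P (-t Σ_{⟨x,y⟩,σ} c†_{xσ} c_{yσ}) P` (projected hopping;
`hamiltonian G t 0` is the pure hopping term of the tree's Hubbard Hamiltonian).
[Tasaki 1989, eq. (1); Tasaki 1998, §4] [cite: Tasaki1989, Theorem] -/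
def hubbardInfty (t : ℝ) : Matrix (Finset (Orb Λ)) (Finset (Orb Λ)) ℂ :=
  gutzwillerProj * hamiltonian G t 0 * gutzwillerProj

/-- The ground-state energy of `H` in the projected (`U = ∞`) `N`-particle sector: infimum of
`Re ⟨ψ, Hψ⟩` over normalised Gutzwiller `N`-particle vectors (junk `sInf ∅ = 0` if the sector is
empty). [Tasaki 1998, §4] [folklore] -/
def gutzwillerGroundEnergy (H : Matrix (Finset (Orb Λ)) (Finset (Orb Λ)) ℂ) (N : ℕ) : ℝ :=
  sInf {E : ℝ | ∃ ψ : Fock (Orb Λ), IsNParticle N ψ ∧ IsGutzwiller ψ ∧ star ψ ⬝ᵥ ψ = 1 ∧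
    E = (expect H ψ).re}

/-- Ground states of `H` in the projected `N`-particle sector: nonzero Gutzwiller `N`-particle
eigenvectors with the sector ground energy. [Tasaki 1998, §4] [folklore] -/
def IsGutzwillerGroundState (H : Matrix (Finset (Orb Λ)) (Finset (Orb Λ)) ℂ) (N : ℕ)
    (ψ : Fock (Orb Λ)) : Prop :=
  IsNParticle N ψ ∧ IsGutzwiller ψ ∧ ψ ≠ 0 ∧
    H *ᵥ ψ = ((gutzwillerGroundEnergy H N : ℝ) : ℂ) • ψ

/-- The projected `N`-particle ground space of `H`: the span of its projected-sector ground
states. [Tasaki 1998, §4] [folklore] -/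
def gutzwillerGroundSpace (H : Matrix (Finset (Orb Λ)) (Finset (Orb Λ)) ℂ) (N : ℕ) :
    Submodule ℂ (Fock (Orb Λ)) :=
  Submodule.span ℂ {ψ | IsGutzwillerGroundState H N ψ}

/-! ### One-hole configurations and Tasaki's connectivity condition -/

/-- The one-hole configurations of `Λ`: occupation sets with `|Λ| - 1` electrons and no double
occupancy (so exactly one empty site and every other site singly occupied). [Tasaki 1989 (basis of
the one-hole `U = ∞` model)] [cite: Tasaki1989, Theorem] -/
def OneHoleConfig (Λ : Type*) [LinearOrder Λ] [Fintype Λ] : Type _ :=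
  {s : Finset (Orb Λ) // s.card = Fintype.card Λ - 1 ∧ ¬ HasDoubleOccupancy s}

/-- The number of up spins of a configuration (fixes `S^z`). [Tasaki 1989] [folklore] -/
def upCount (s : Finset (Orb Λ)) : ℕ :=
  (Finset.univ.filter fun x : Λ => orb x 0 ∈ s).card

/-- Two one-hole configurations differ by ONE HOP OF THE HOLE along the edge `{x, y}` of `G`: an
electron moves from `y` to the empty site `x` keeping its spin `σ`.
[Tasaki 1989, connectivity condition] [cite: Tasaki1989, Theorem] -/
def IsHoleHop (s s' : Finset (Orb Λ)) : Prop :=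
  ∃ (x y : Λ) (σ : Fin 2), G.Adj x y ∧ orb y σ ∈ s ∧ orb x 0 ∉ s ∧ orb x 1 ∉ s ∧
    s' = insert (orb x σ) (s.erase (orb y σ))

/-- The hole-hopping graph on one-hole configurations. [Tasaki 1989] [folklore] -/
def holeHopGraph : SimpleGraph (OneHoleConfig Λ) :=
  SimpleGraph.fromRel fun s s' => IsHoleHop G s.1 s'.1

/-- **Tasaki's connectivity condition** for `(Λ, G)`: any two one-hole configurations with the same
number of up spins (same `S^z`) are joined by a chain of hole hops (Mathlib
`SimpleGraph.Reachable` in `holeHopGraph G`). This is a HYPOTHESIS on the lattice — a predicate in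
the explicit argument `G`, the assumption of the Nagaoka–Tasaki theorem (`nagaoka_tasaki_neg` in the
companion file) — not an assertion: it fails for two
sites without a bond and holds for the complete graph (`not_satisfiesConnectivity_bot`,
`satisfiesConnectivity_top` in `NagaokaTasakiConnectivity.lean`); Tasaki: satisfied by most two- and
three-dimensional lattices (triangular, square, cubic, … with suitable boundary conditions).
[Tasaki 1989, the connectivity condition; Tasaki 1998, §4] [cite: Tasaki1989, Theorem] -/
def SatisfiesConnectivity (G : SimpleGraph Λ) : Prop :=
  ∀ s s' : OneHoleConfig Λ, upCount s.1 = upCount s'.1 → (holeHopGraph G).Reachable s s'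

/-! ### API -/

/-- The Gutzwiller projector fixes exactly the Gutzwiller vectors. [Tasaki 1998, §4] [folklore] -/
theorem gutzwillerProj_mulVec_eq_self_iff (ψ : Fock (Orb Λ)) :
    gutzwillerProj *ᵥ ψ = ψ ↔ IsGutzwiller ψ := by
  constructor
  · intro h s hs
    have := congrFun h s
    simp only [gutzwillerProj, mulVec_diagonal, hs, if_true, zero_mul] at this
    exact this.symm
  · intro h
    funext s
    simp only [gutzwillerProj, mulVec_diagonal]
    by_cases hs : HasDoubleOccupancy s
    · simp [hs, h s hs]
    · simp [hs]

/-- The Gutzwiller projector is idempotent. [folklore] -/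
theorem gutzwillerProj_mul_self :
    (gutzwillerProj : Matrix (Finset (Orb Λ)) _ ℂ) * gutzwillerProj = gutzwillerProj := by
  rw [gutzwillerProj, diagonal_mul_diagonal]
  congr 1
  funext s
  by_cases hs : HasDoubleOccupancy s <;> simp [hs]

/-- The Gutzwiller projector is Hermitian (real diagonal). [folklore] -/
theorem gutzwillerProj_isHermitian :
    (gutzwillerProj : Matrix (Finset (Orb Λ)) _ ℂ).IsHermitian := by
  rw [gutzwillerProj]
  refine Matrix.isHermitian_diagonal_iff.2 fun s => ?_
  by_cases hs : HasDoubleOccupancy s <;> simp [hs]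

omit [Fintype Λ] [DecidableRel G.Adj] in
/-- A hole hop preserves the number of up spins (it moves one electron with its spin), so hops stay
inside an `S^z` sector — the sectors are the natural connected pieces in `SatisfiesConnectivity`.
[Tasaki 1989] [folklore] -/
theorem IsHoleHop.card_eq {s s' : Finset (Orb Λ)} (h : IsHoleHop G s s') : s'.card = s.card := by
  obtain ⟨x, y, σ, -, hy, hx0, hx1, rfl⟩ := h
  have hxσ : orb x σ ∉ s.erase (orb y σ) := by
    fin_cases σ
    · exact fun h' => hx0 (Finset.mem_of_mem_erase h')
    · exact fun h' => hx1 (Finset.mem_of_mem_erase h')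
  rw [Finset.card_insert_of_notMem hxσ, Finset.card_erase_of_mem hy]
  have : 0 < s.card := Finset.card_pos.2 ⟨_, hy⟩
  omega

end Literature.MathematicalPhysics.QuantumLattice
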